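import Literature.MathematicalPhysics.QuantumFieldTheory.Balaban1983to89.B9Eq39Adjoint

/-!
# `Balaban1983to89.B9Eq31ActionZpow` — [Balaban1985BackgroundPropagators] (3.1) p. 390 WITH THE PRINTED WEIGHT `η^{d−4}` AS AN INTEGER
# POWER (every dimension `d`, in particular `d = 3`), and the expansion (3.12) p. 392 for it — a twin of the pre-cell carrier
# `B9Eq39Adjoint.action` answering the located scope note L6-1 of the B11 second reader (cell `lit-balaban`, seat r06 gen 18)

statement-level skeleton of published theorems with citation tags; proofs where landed; nothing here is a claim about the Yang–Mills mass gap

CITATION HEADER (lean-in-tree rule).  B9 = T. Bałaban, *Propagators for lattice gauge theories in a background field*, Commun. Math. Phys. **99**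
(1985) 389–434 [Balaban1985BackgroundPropagators] (doi 10.1007/bf01240355; `paper:balaban1985-cmp99-background-propagators`, journal page = PDF
page + 388): (3.1) p. 390 [PDF 2] «A^η(U′U₀) = Σ_{p⊂T_η} η^{d−4}[1 − Re tr(U′U₀)(∂p)]», (3.7) p. 391 [PDF 3], (3.10)–(3.12) p. 392 [PDF 4] («The
expansion (3.7) can be written now as» (3.12) `A^η(exp iηA U) = A^η(U) + ⟨A,J⟩ + ½⟨A,ΔA⟩ + ⋯`).  Pages re-read by this seat (r06 gen 18) as text
`p0002`–`p0004` of the held paper.  Consumers of the weight at `d = 3`: [16] = T. Bałaban, *Ultraviolet stability of three-dimensional lattice pure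
gauge field theories*, Commun. Math. Phys. **102** (1985) 255–275 [Balaban1985UV3] (cell paper B10; (19) there), and [15] = T. Bałaban, *The variational
problem and background fields in renormalization group method for lattice gauge theories*, Commun. Math. Phys. **102** (1985) 277–309
[Balaban1985Variational] (cell paper B11; (26) p. 282 there) — both written for general `d` with the weight `η^{d−4}`.  Cell `lit-balaban`, seat r06 (B9 fold owner) gen 18; SKELETON rows **B9.Eq3.1** × **B9.Eq3.12**
(cells; heads unchanged).

WHY THIS FILE (second-reader note L6-1, `lit-balaban-r11/SECOND-READ-B11.md` §6, 2026-08-22).  The pre-cell carrier `B9Eq39Adjoint.action η d τ V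
:= Σ_p (η:ℂ)^(d-4) · wil τ (V(∂p))` types the exponent with NATURAL-NUMBER subtraction `d - 4`, so every (3.12)-based theorem of the tree
(`B9Eq39Adjoint.eq312`, and downstream `B11Eq26ActionExpansion`, `B11Eq26FirstVariation`, the B10 knit `B10Eq19LinearTerm` §5) is stated under
`4 ≤ d`; at `d = 3` — the dimension of [16] — the truncated subtraction would turn the printed `η^{d−4} = η⁻¹` into `η⁰`, and the theorems
are empty there.  The print ((3.1) of B9, (19) of [16], (26) of [15]) is written for general `d`.  This file adds, WITHOUT touching the carrier
(def-body guard; many dependants), the faithful twin with the INTEGER power `(η:ℂ)^((d:ℤ) − 4)`: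
* `actionZ` — (3.1) for every `d`; `actionZ_eq_action` — it IS `B9Eq39Adjoint.action` when `4 ≤ d`; `actionZ_three` — at `d = 3` the weight is
  `η⁻¹` as printed; `actionZ_four` — at `d = 4` the weight is `1`.
* `eq37_summand_zpow` — the (3.7) summand multiplied by the printed weight, every `d` (`η ≠ 0`; `zpow_sub₀` in place of the carrier's
  `Nat.add_sub_cancel_left`), `summand_split_zpow`, `eq312_letters_zpow`, and
* **`eq312_zpow`** — (3.12) EXACT BACKGROUND, FINITE LATTICE, EVERY `d`: `A^η(U′U₀) = A^η(U₀) + ⟨A,J⟩ + ½⟨A,ΔA⟩ + η^{d−4}Σ_p ρ_p` with the SAME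
  printed letters `bondPair`, `J`, `hessPair`, `rem3` of the carrier (their weights `η^d`, `η⁻¹`, `η⁻²` never involved the subtraction) — the
  carrier's proof verbatim in substance.
Consumers at `d = 3` (r07's B10 files, r08's B11 files) may re-base on `actionZ`/`eq312_zpow` at their discretion; for `4 ≤ d` nothing changes
(`actionZ_eq_action`).

HONEST SCOPE.  (a) Finite non-commutative algebra only, exactly as the carrier's §6: tracial `τ` in the rôle of the normalised trace, background
`U₀` arbitrary units (no smallness, no unitarity), `η ≠ 0` real; the remainder `ρ_p` is the carrier's `rem3` (third order, `B9Eq39Adjoint.norm_rem3_le`).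
(b) Nothing of (3.2)–(3.11) is re-declared: all letters are the carrier's, imported BY NAME.  (c) No named fact, no row head change (B9.Eq3.1 and
B9.Eq3.12 stay proved-existing; this file widens the typed scope of their Lean cells from `4 ≤ d` to every `d`).

Depends on: `B9Eq39Adjoint` (`action`, `posPlaq`, `wil`, `plaqU`, `prodCfg`, `curlη`, `curl`, `bondPair`, `J`, `hessPair`, `deltaPrime`, `rem3`,
`plaqD_lettersA`, `bondPair_J`, `bondPair_divPη_curlη`, `wil_plaqU_prodCfg`), `B9Eq37Insertion` (`eq37_summand`, `letters`, `lettersA`, `plaqD`,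
`holU`, `rem`, `invPath`, `reC`, `imC`), `Beta.TransportVertices` (`commSum`) — all used BY NAME.
-/

noncomputable section

open NormedSpace Complex

namespace Literature.MathematicalPhysics.QuantumFieldTheory.Balaban1983to89.B9Eq31ActionZpow

open Literature.MathematicalPhysics.QuantumFieldTheory.Balaban1983to89
open Literature.MathematicalPhysics.QuantumFieldTheory.Balaban1983to89.Beta.TransportVertices
open Literature.MathematicalPhysics.QuantumFieldTheory.Balaban1983to89.Beta.AdjointTransportJets
open Literature.MathematicalPhysics.QuantumFieldTheory.Balaban1983to89.B9Eq37Insertion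
open Literature.MathematicalPhysics.QuantumFieldTheory.Balaban1983to89.B9Eq39Adjoint

section ActionZ

variable {𝔸 : Type*} [NormedRing 𝔸] [NormedAlgebra ℂ 𝔸] [CompleteSpace 𝔸]
variable {S : Type*} [Fintype S] {ι : Type*} [Fintype ι] [LinearOrder ι]
variable (T : ι → Equiv.Perm S) (U : ι → S → 𝔸ˣ)

/-- **(3.1) FOR EVERY DIMENSION** — «A^η(U′U₀) = Σ_{p⊂T_η} η^{d−4}[1 − Re tr(U′U₀)(∂p)]» (p. 390) in the complexified reading of p. 391
(`B9Eq37Insertion.wil τ W = τ1 − τ Re W`), with the weight `η^{d−4}` as the INTEGER power `(η:ℂ)^((d:ℤ) − 4)` (so `η⁻¹` at `d = 3`, `1` at `d = 4`);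
the twin of `B9Eq39Adjoint.action` (natural-number exponent `d - 4`). [cite: Balaban1985BackgroundPropagators, (3.1) p.390, p.391] -/
def actionZ (η : ℝ) (d : ℕ) (τ : 𝔸 →ₗ[ℂ] ℂ) (V : ι → S → 𝔸ˣ) : ℂ :=
  ∑ q ∈ posPlaq S ι, (η : ℂ) ^ ((d : ℤ) - 4) * wil τ (plaqU T V q.2.1 q.2.2 q.1)

omit [CompleteSpace 𝔸] [Fintype S] [Fintype ι] [LinearOrder ι] in
/-- For `4 ≤ d` the integer power IS the carrier's natural power: `(η:ℂ)^((d:ℤ)−4) = (η:ℂ)^(d−4)`.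
[cite: Balaban1985BackgroundPropagators, (3.1) p.390 (bookkeeping ours)] -/
theorem zpow_dim_eq_pow (η : ℝ) {d : ℕ} (hd : 4 ≤ d) : (η : ℂ) ^ ((d : ℤ) - 4) = (η : ℂ) ^ (d - 4) := by
  rw [show ((d : ℤ) - 4) = ((d - 4 : ℕ) : ℤ) by omega, zpow_natCast]

omit [CompleteSpace 𝔸] in
/-- **`actionZ` IS `B9Eq39Adjoint.action` WHEN `4 ≤ d`** (nothing changes for the existing consumers).
[cite: Balaban1985BackgroundPropagators, (3.1) p.390] -/
theorem actionZ_eq_action (η : ℝ) {d : ℕ} (hd : 4 ≤ d) (τ : 𝔸 →ₗ[ℂ] ℂ) (V : ι → S → 𝔸ˣ) :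
    actionZ T η d τ V = action T η d τ V := by
  simp only [actionZ, action, zpow_dim_eq_pow η hd]

omit [CompleteSpace 𝔸] in
/-- **AT `d = 3` THE WEIGHT IS `η⁻¹`** — the printed `η^{d−4}` of (3.1) at the dimension `d = 3` of [16] (whose knit `B10Eq19LinearTerm` consumes
(3.12) through (26) of [15]), which the natural-number exponent of the carrier cannot express. [cite: Balaban1985BackgroundPropagators, (3.1) p.390] -/
theorem actionZ_three (η : ℝ) (τ : 𝔸 →ₗ[ℂ] ℂ) (V : ι → S → 𝔸ˣ) :
    actionZ T η 3 τ V = ∑ q ∈ posPlaq S ι, ((η : ℂ)⁻¹) * wil τ (plaqU T V q.2.1 q.2.2 q.1) := by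
  simp only [actionZ, Nat.cast_ofNat, show ((3 : ℤ) - 4) = -1 by norm_num, zpow_neg, zpow_one]

omit [CompleteSpace 𝔸] in
/-- At `d = 4` the weight is `1`. [cite: Balaban1985BackgroundPropagators, (3.1) p.390] -/
theorem actionZ_four (η : ℝ) (τ : 𝔸 →ₗ[ℂ] ℂ) (V : ι → S → 𝔸ˣ) :
    actionZ T η 4 τ V = ∑ q ∈ posPlaq S ι, wil τ (plaqU T V q.2.1 q.2.2 q.1) := by
  simp only [actionZ, Nat.cast_ofNat, sub_self, zpow_zero, one_mul]

omit [Fintype S] [Fintype ι] [LinearOrder ι] in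
/-- **THE (3.7) SUMMAND WITH THE PRINTED WEIGHT, EVERY `d`**: multiplying `B9Eq37Insertion.eq37_summand` by `η^{d−4} = (η:ℂ)^((d:ℤ)−4)` (`η ≠ 0`),
`η^{d−4}(wil τ (P·W) − wil τ W) = η^d τ(X·η⁻²Im W) + ½η^d[τ(X²·Re W) + τ((i·C)·η⁻²Im W)] + η^{d−4}·(remainder)` — the carrier's
`eq37_summand_dim` without `4 ≤ d` (`zpow_sub₀` in place of `Nat.add_sub_cancel_left`). [cite: Balaban1985BackgroundPropagators, (3.1) p.390, (3.7) p.391] -/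
theorem eq37_summand_zpow (τ : 𝔸 →ₗ[ℂ] ℂ) (hτ : ∀ a b : 𝔸, τ (a * b) = τ (b * a)) (η : ℝ) (hη : η ≠ 0) (d : ℕ)
    (A : List 𝔸) (W : 𝔸ˣ) :
    (η : ℂ) ^ ((d : ℤ) - 4) * (wil τ (holU (letters η A) * W) - wil τ W)
      = (η : ℂ) ^ d * τ (plaqD η A * (((η : ℂ)⁻¹ ^ 2) • imC W))
        + 2⁻¹ * (η : ℂ) ^ d * (τ (plaqD η A * plaqD η A * reC W) + τ ((I • commSum A) * (((η : ℂ)⁻¹ ^ 2) • imC W)))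
        + (η : ℂ) ^ ((d : ℤ) - 4) * (-(2 : ℂ)⁻¹ * (τ (rem (letters η A) * (W : 𝔸))
            + τ (((W⁻¹ : 𝔸ˣ) : 𝔸) * rem (invPath (letters η A))))) := by
  rw [eq37_summand τ hτ η]
  simp only [mul_smul_comm, map_smul, smul_eq_mul]
  have hη' : (η : ℂ) ≠ 0 := Complex.ofReal_ne_zero.mpr hη
  have hz : (η : ℂ) ^ ((d : ℤ) - 4) = (η : ℂ) ^ d * ((η : ℂ)⁻¹) ^ 4 := by
    rw [zpow_sub₀ hη', zpow_natCast, div_eq_mul_inv, ← inv_zpow]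
    norm_cast
  rw [hz]
  field_simp
  ring

omit [CompleteSpace 𝔸] [Fintype S] [Fintype ι] [LinearOrder ι] in
/-- `(aX)(aX)Y = X·X·(a²Y)` (the carrier's private rearrangement, re-proved here). [cite: Balaban1985BackgroundPropagators, (3.10) p.392 (bookkeeping ours)] -/
private theorem smul_sq_mul (a : ℂ) (X Y : 𝔸) : (a • X) * (a • X) * Y = X * X * ((a ^ 2) • Y) := by
  simp only [smul_mul_assoc, mul_smul_comm, smul_smul, pow_two]

omit [Fintype S] [Fintype ι] [LinearOrder ι] in
/-- THE (3.7) SUMMAND OF ONE PLAQUETTE WITH THE PRINTED WEIGHT, REARRANGED INTO THE (3.10)/(3.11) TERMS, EVERY `d` — the carrier's `summand_split`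
with the integer power: `η^{d−4}(wil τ (P·W) − wil τ W) = η^d τ(X·η⁻²Im W) + ½[η^d τ(X²) + η^d(τ((D¹A)²·η⁻²(Re W − 1)) + τ(iC·η⁻²Im W))] + η^{d−4}ρ`.
[cite: Balaban1985BackgroundPropagators, (3.7) p.391, (3.10) p.392] -/
theorem summand_split_zpow (τ : 𝔸 →ₗ[ℂ] ℂ) (hτ : ∀ a b : 𝔸, τ (a * b) = τ (b * a)) (η : ℝ) (hη : η ≠ 0) (d : ℕ)
    (A : ι → S → 𝔸) (μ ν : ι) (x : S) :
    (η : ℂ) ^ ((d : ℤ) - 4) * (wil τ (holU (letters η (lettersA T U A μ ν x)) * plaqU T U μ ν x) - wil τ (plaqU T U μ ν x))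
      = (η : ℂ) ^ d * τ (curlη T U η A μ ν x * ((((η : ℂ)⁻¹) ^ 2) • imC (plaqU T U μ ν x)))
        + 2⁻¹ * ((η : ℂ) ^ d * τ (curlη T U η A μ ν x * curlη T U η A μ ν x)
          + (η : ℂ) ^ d * (τ (curl T U A μ ν x * curl T U A μ ν x
              * ((((η : ℂ)⁻¹) ^ 2) • (reC (plaqU T U μ ν x) - 1)))
            + τ ((I • commSum (lettersA T U A μ ν x)) * ((((η : ℂ)⁻¹) ^ 2) • imC (plaqU T U μ ν x)))))
        + (η : ℂ) ^ ((d : ℤ) - 4) * rem3 T U η τ A μ ν x := by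
  rw [eq37_summand_zpow τ hτ η hη d, plaqD_lettersA, rem3]
  have hsplit : τ (curlη T U η A μ ν x * curlη T U η A μ ν x * reC (plaqU T U μ ν x))
      = τ (curlη T U η A μ ν x * curlη T U η A μ ν x)
        + τ (curl T U A μ ν x * curl T U A μ ν x * ((((η : ℂ)⁻¹) ^ 2) • (reC (plaqU T U μ ν x) - 1))) := by
    rw [← map_add, curlη, ← smul_sq_mul, mul_sub, mul_one]
    congr 1
    abel
  rw [hsplit]
  ring

/-- **(3.12) ON A FINITE LATTICE, EXACT BACKGROUND, LEAF FORM, EVERY `d`**: `Σ_p η^{d−4}(wil τ (P_p·U(∂p)) − wil τ U(∂p)) = ⟨A,J⟩ + ½⟨A,ΔA⟩ +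
η^{d−4}Σ_p ρ_p` with the carrier's printed letters `J` (3.11), `⟨A,ΔA⟩ = ⟨A,D*DA⟩ + ⟨A,Δ′A⟩` (3.10) and `ρ_p` third order — the carrier's
`eq312_letters` with the integer power. [cite: Balaban1985BackgroundPropagators, (3.10) p.392, (3.11) p.392, (3.12) p.392] -/
theorem eq312_letters_zpow (τ : 𝔸 →ₗ[ℂ] ℂ) (hτ : ∀ a b : 𝔸, τ (a * b) = τ (b * a)) (η : ℝ) (hη : η ≠ 0) (d : ℕ)
    (A : ι → S → 𝔸) :
    ∑ q ∈ posPlaq S ι, (η : ℂ) ^ ((d : ℤ) - 4) *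
        (wil τ (holU (letters η (lettersA T U A q.2.1 q.2.2 q.1)) * plaqU T U q.2.1 q.2.2 q.1)
          - wil τ (plaqU T U q.2.1 q.2.2 q.1))
      = bondPair η d τ A (J T U η) + 2⁻¹ * hessPair T U η d τ A
        + (η : ℂ) ^ ((d : ℤ) - 4) * ∑ q ∈ posPlaq S ι, rem3 T U η τ A q.2.1 q.2.2 q.1 := by
  rw [Finset.sum_congr rfl fun q _ => summand_split_zpow T U τ hτ η hη d A q.2.1 q.2.2 q.1]
  rw [hessPair, bondPair_J T U τ hτ, bondPair_divPη_curlη T U τ hτ, deltaPrime]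
  simp only [Finset.sum_add_distrib, ← Finset.mul_sum]

/-- **(3.12), EXACT BACKGROUND, FINITE LATTICE, EVERY DIMENSION `d`** ((3.12) p. 392: `A^η(exp iηA U) = A^η(U) + ⟨A,J⟩ + ½⟨A,ΔA⟩ + ⋯`):
`A^η(U′U₀) = A^η(U₀) + ⟨A,J⟩ + ½⟨A,ΔA⟩ + η^{d−4}Σ_p ρ_p` for the integer-power action `actionZ`, `J = D^{η*}η⁻² Im ∂U₀` (3.11), `⟨A,ΔA⟩ =
⟨A,D*D_U A⟩ + ⟨A,Δ′A⟩` (3.10), the background `U₀` arbitrary units, `η ≠ 0`, and `‖ρ_p‖` third order in `η·Σ‖A′(b)‖` (`B9Eq39Adjoint.norm_rem3_le`);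
at `4 ≤ d` this is `B9Eq39Adjoint.eq312` (`actionZ_eq_action`), at `d = 3` (the dimension of [16]; its knit `B10Eq19LinearTerm` §5 and r08's `B11Eq26ActionExpansion` carried `4 ≤ d` from the
carrier) it is no longer vacuous — see the example at the end of the file. [cite: Balaban1985BackgroundPropagators, (3.12) p.392, (3.1) p.390] -/
theorem eq312_zpow (τ : 𝔸 →ₗ[ℂ] ℂ) (hτ : ∀ a b : 𝔸, τ (a * b) = τ (b * a)) (η : ℝ) (hη : η ≠ 0) (d : ℕ)
    (A : ι → S → 𝔸) :
    actionZ T η d τ (prodCfg U η A)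
      = actionZ T η d τ U + bondPair η d τ A (J T U η) + 2⁻¹ * hessPair T U η d τ A
        + (η : ℂ) ^ ((d : ℤ) - 4) * ∑ q ∈ posPlaq S ι, rem3 T U η τ A q.2.1 q.2.2 q.1 := by
  have h := eq312_letters_zpow T U τ hτ η hη d A
  simp only [mul_sub, Finset.sum_sub_distrib, ← wil_plaqU_prodCfg T U τ hτ η A] at h
  rw [actionZ, actionZ, add_assoc, add_assoc, ← add_assoc (bondPair η d τ A (J T U η)), ← h]
  abel

end ActionZ

/-! ## Sanity examples -/

section Examples

variable {𝔸 : Type*} [NormedRing 𝔸] [NormedAlgebra ℂ 𝔸] [CompleteSpace 𝔸]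
variable {S : Type*} [Fintype S] {ι : Type*} [Fintype ι] [LinearOrder ι]
variable (T : ι → Equiv.Perm S) (U : ι → S → 𝔸ˣ)

/-- At `d = 3` (the dimension of [16]) the (3.12) expansion is NOT vacuous: the weight is `η⁻¹` on both sides. -/
example (τ : 𝔸 →ₗ[ℂ] ℂ) (hτ : ∀ a b : 𝔸, τ (a * b) = τ (b * a)) (η : ℝ) (hη : η ≠ 0) (A : ι → S → 𝔸) :
    ∑ q ∈ posPlaq S ι, ((η : ℂ)⁻¹) * wil τ (plaqU T (prodCfg U η A) q.2.1 q.2.2 q.1)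
      = ∑ q ∈ posPlaq S ι, ((η : ℂ)⁻¹) * wil τ (plaqU T U q.2.1 q.2.2 q.1)
        + bondPair η 3 τ A (J T U η) + 2⁻¹ * hessPair T U η 3 τ A
        + ((η : ℂ)⁻¹) * ∑ q ∈ posPlaq S ι, rem3 T U η τ A q.2.1 q.2.2 q.1 := by
  have h := eq312_zpow T U τ hτ η hη 3 A
  rw [actionZ_three, actionZ_three] at h
  simpa only [Nat.cast_ofNat, show ((3 : ℤ) - 4) = -1 by norm_num, zpow_neg, zpow_one] using h

end Examples

end Literature.MathematicalPhysics.QuantumFieldTheory.Balaban1983to89.B9Eq31ActionZpow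

end
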